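import Summits.MatrixMultiplication.OmegaCensus.STPPVosperSlackTwoCheckers

/-!
# ω-census (abelian STPP census): the slack-2 partition CHECKERS for leaves with SEVERAL other blocks — pinned-sumset gauges, dead-table leaf (kernel tool)

HONEST FRAMING (pub-omega census; verbatim): lottery ticket; floor = certified bounds/negative ranges.
Census STRUCTURE (seat pub-omega-stpp-1 gen 33, 2026-08-28), family (b2).  The computational half of the slack-2 partition law
(`STPPVosperSlackTwoShapes.lean`, `STPPVosperSlackTwoCheckers.lean`, HOME `pub-omega-stpp-1-g32/SLACK2-DESIGN.md`) for a leaf whose block `i`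
(`C`-reading `(P, Q, R′)` of sizes `(a, b, c)`) has TWO OR MORE other blocks — the ℤ₅₉ leaves `{(2,2,2),(3,3,3)²}`, `{(2,2,3),(3,4,2)²}`,
`{(2,3,3),(2,3,4),(3,2,3)}`.  Two changes with respect to the one-other-block checkers `caseADeadQ'` / `caseCDeadQP'`:

* CHEAPER GAUGES.  The `N + 2` translation freedoms are spent on the block-`i` translation (`P` based at `0`), the global `B`-offset (`Q` based at `0`)
  and the global `C`-offset, which now pins the RIGID SUMSET instead of a translate of the pattern: in case A the Vosper interval
  `SY = −P + Y° = [0, a + L − 1)` (`P = [0, a)`, `Y° = [a − 1, a − 1 + L)`), in case C the Hamidoune–Rødseth set `Z° = [0, z] ∖ {h₀}` (`h₀ ∈ [1, z]`),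
  hence `T = −Q + Z°`.  All `c` translates of the pattern are then free (`tilesAll` with `k = c` from the cover `SY` resp. `T`); there is no interval-
  position loop and no hole loop.  (Python mirror, HOME `pub-omega-stpp-1-g33/code/s2w_mirror.py`, `s2w_mirrorC2.py`: 10–40× fewer search nodes than
  the translate-pinned gauge on the ℤ₅₉ leaves.)
* DEAD-TABLE LEAF.  With several other blocks the last stage is not a realisation of one block but the words cover `existsCoverW`
  (`STPPVosperTilingWords.lean`) of the value lists `(Y°, Z°)` by the other blocks' difference sets; these searches are the expensive part and few
  (≤ 64 per leaf and case), so the leaf only LOOKS UP the pair `(Yo, Zo)` in a table `tbl`, and the law takes the table's deadness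
  (`existsCoverW … = false`, any sound orientation / block order / enumerator) as separate row hypotheses.

Contents: `caseALeafT`, `caseADeadT p a c L z Q tbl` (case A; case B′ = case A of the role-swapped family), `caseCLeafT`, `caseCDeadT p c L z Q P h₀ tbl`
(case C, per hole `h₀`), and the control-flow lemmas the soundness proofs consume (`mem_of_caseALeafT`, `caseALeafT_of_caseADeadT`, `mem_of_caseCLeafT`,
`caseCLeafT_of_caseCDeadT`) over `tilesAll_complete`.  Soundness (normal form + reduction) and the laws are separate files.  Nothing here is progress on `ω`.

References: H. Cohn, R. Kleinberg, B. Szegedy, C. Umans, FOCS 2005 (arXiv:math/0511460), Def. 5.1; A. G. Vosper, J. London Math. Soc. 31 (1956);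
Y. O. Hamidoune, Ø. J. Rødseth, Acta Arith. 92 (2000).
-/

namespace Summit.MatrixMultiplication.OmegaCensus.CubeNB.S2

open Summit.MatrixMultiplication.OmegaCensus.CubeNB.Bits

/-! ## §1 Case A (and B′ by role swap), pinned Vosper interval -/

/-- **Leaf of case A, table form.**  At a tiling with cover `cov` (`= W ∪ SY` as a bit mask): `Tfree = univ ∖ cov`, the `Z°`-candidate mask
`Zc = ⋂_{q ∈ Q} (Tfree + q)` must have at least `z` members, and every `z`-sublist `Zo` of its members, paired with the fixed `Yo = [a − 1, a − 1 + L)`,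
must be in the dead table `tbl`.  (The tiling positions are not needed at this stage.) [cite: CohnKleinbergSzegedyUmans2005, Def. 5.1] -/
def caseALeafT (p a L z : ℕ) (Q : List ℕ) (tbl : List (List ℕ × List ℕ)) (_R : List ℕ) (cov : ℕ) : Bool :=
  let tfree := fullMask p ^^^ cov
  let zc := Q.foldl (fun m q => m &&& rot p tfree q) (fullMask p)
  !(Nat.ble z (popc (List.range p) zc)) ||
    (let Yo := (List.range L).map fun t => a - 1 + t
     ((members (List.range p) zc).sublistsLen z).all fun Zo => decide ((Yo, Zo) ∈ tbl))

/-- **Case A is dead for the free shape `Q`, table form** (`P = [0, a)`, `SY = [0, a + L − 1)` pinned; `c` free translates of the pattern `P + Q`,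
increasing positions, pairwise disjoint and disjoint from `SY`; then the leaf). [cite: CohnKleinbergSzegedyUmans2005, Def. 5.1]
[cite: Vosper1956, main theorem; Nathanson1996, Thm 2.7] -/
def caseADeadT (p a c L z : ℕ) (Q : List ℕ) (tbl : List (List ℕ × List ℕ)) : Bool :=
  let patt := pattPQ p (List.range a) Q
  !(decide patt.Nodup) || tilesAll (caseALeafT p a L z Q tbl) c (transMasks p patt) [] (maskOf (List.range (a + L - 1)))

/-! ## §2 Case C, pinned Hamidoune–Rødseth set `Z°` -/

/-- **Leaf of case C, table form.**  At a tiling with cover `cov` (`= W ∪ T`): `SY = univ ∖ cov` (the partition is exact), the `Y°`-candidate mask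
`Yc = ⋂_{x ∈ P} (SY + x)` must have at least `L` members, and every `L`-sublist `Yo` of its members with `−P + Yo = SY` (as masks), paired with the fixed
`Zo`, must be in the dead table `tbl`. [cite: CohnKleinbergSzegedyUmans2005, Def. 5.1] -/
def caseCLeafT (p L : ℕ) (P Zo : List ℕ) (tbl : List (List ℕ × List ℕ)) (_R : List ℕ) (cov : ℕ) : Bool :=
  let sy := fullMask p ^^^ cov
  let yc := P.foldl (fun m x => m &&& rot p sy x) (fullMask p)
  !(Nat.ble L (popc (List.range p) yc)) ||
    ((members (List.range p) yc).sublistsLen L).all fun Yo =>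
      !(Nat.beq (P.foldl (fun m x => m ||| rot p (maskOf Yo) (p - x)) 0) sy) || decide ((Yo, Zo) ∈ tbl)

/-- **Case C is dead for the shapes `(Q, P)` and the hole `h₀`, table form** (`Z° = [0, z] ∖ {h₀}` pinned, `T = −Q + Z°` must have `|Q| + z` points;
`c` free translates of `P + Q` disjoint from `T`; then the leaf). [cite: CohnKleinbergSzegedyUmans2005, Def. 5.1]
[cite: HamidouneRodseth2000, main theorem (§1, p. 252)] -/
def caseCDeadT (p c L z : ℕ) (Q P : List ℕ) (h₀ : ℕ) (tbl : List (List ℕ × List ℕ)) : Bool :=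
  let patt := pattPQ p P Q
  !(decide patt.Nodup) ||
    (let Zo := (List.range (z + 1)).filter fun t => !(Nat.beq t h₀)
     let tM := Q.foldl (fun m q => m ||| rot p (maskOf Zo) (p - q)) 0
     !(Nat.beq (popc (List.range p) tM) (Q.length + z)) || tilesAll (caseCLeafT p L P Zo tbl) c (transMasks p patt) [] tM)

/-! ## §3 Control flow: the leaves are exhaustive -/

/-- **The case-A leaf is exhaustive**: if it returns `true`, every `z`-sublist `Zo` of the members of the candidate mask is, with `Yo`, in the table.
[cite: CohnKleinbergSzegedyUmans2005, Def. 5.1] -/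
theorem mem_of_caseALeafT {p a L z : ℕ} {Q : List ℕ} {tbl : List (List ℕ × List ℕ)} {R : List ℕ} {cov : ℕ}
    (h : caseALeafT p a L z Q tbl R cov = true) (Zo : List ℕ)
    (hZo : Zo ∈ (members (List.range p) (Q.foldl (fun m q => m &&& rot p (fullMask p ^^^ cov) q) (fullMask p))).sublistsLen z) :
    (((List.range L).map fun t => a - 1 + t), Zo) ∈ tbl := by
  unfold caseALeafT at h
  simp only [Bool.or_eq_true, Bool.not_eq_true', List.all_eq_true, decide_eq_true_eq] at h
  rcases h with h | h
  · exfalso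
    have hlen := List.mem_sublistsLen.1 hZo
    have hle := hlen.1.length_le
    rw [hlen.2, ← popc_eq_length_members] at hle
    rw [Nat.ble_eq_true_of_le hle] at h
    exact Bool.noConfusion h
  · exact h Zo hZo

/-- **Case A is exhaustive**: if `caseADeadT … = true` and the pattern is duplicate-free, then for every sequentially admissible choice `rs` of `c`
translates (a sublist of `transMasks`) from the cover `SY`, the leaf holds at the resulting tiling. [cite: CohnKleinbergSzegedyUmans2005, Def. 5.1] -/
theorem caseALeafT_of_caseADeadT {p a c L z : ℕ} {Q : List ℕ} {tbl : List (List ℕ × List ℕ)} (h : caseADeadT p a c L z Q tbl = true)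
    (hpatt : (pattPQ p (List.range a) Q).Nodup) (rs : List (ℕ × ℕ)) (hsub : rs.Sublist (transMasks p (pattPQ p (List.range a) Q)))
    (hlen : rs.length = c) (hadm : admissible (maskOf (List.range (a + L - 1))) rs = true) :
    caseALeafT p a L z Q tbl (rs.map Prod.fst) (rs.foldl (fun cv x => cv ||| x.2) (maskOf (List.range (a + L - 1)))) = true := by
  unfold caseADeadT at h
  simp only [hpatt, decide_true, Bool.not_true, Bool.false_or] at h
  by_contra hleaf
  rw [Bool.not_eq_true] at hleaf
  have key := tilesAll_complete (caseALeafT p a L z Q tbl) _ rs [] _ hsub hadm (by simpa using hleaf)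
  rw [hlen, h] at key
  exact Bool.noConfusion key

/-- **The case-C leaf is exhaustive**: if it returns `true`, every `L`-sublist `Yo` of the members of the candidate mask whose sumset mask `−P + Yo`
equals `univ ∖ cov` is, with `Zo`, in the table. [cite: CohnKleinbergSzegedyUmans2005, Def. 5.1] -/
theorem mem_of_caseCLeafT {p L : ℕ} {P Zo : List ℕ} {tbl : List (List ℕ × List ℕ)} {R : List ℕ} {cov : ℕ}
    (h : caseCLeafT p L P Zo tbl R cov = true) (Yo : List ℕ)
    (hYo : Yo ∈ (members (List.range p) (P.foldl (fun m x => m &&& rot p (fullMask p ^^^ cov) x) (fullMask p))).sublistsLen L)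
    (hsy : P.foldl (fun m x => m ||| rot p (maskOf Yo) (p - x)) 0 = fullMask p ^^^ cov) : (Yo, Zo) ∈ tbl := by
  unfold caseCLeafT at h
  simp only [Bool.or_eq_true, Bool.not_eq_true', List.all_eq_true, decide_eq_true_eq] at h
  rcases h with h | h
  · exfalso
    have hlen := List.mem_sublistsLen.1 hYo
    have hle := hlen.1.length_le
    rw [hlen.2, ← popc_eq_length_members] at hle
    rw [Nat.ble_eq_true_of_le hle] at h
    exact Bool.noConfusion h
  · rcases h Yo hYo with h | h
    · rw [hsy, Nat.beq_refl] at h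
      exact absurd h Bool.false_ne_true.symm
    · exact h

/-- **Case C is exhaustive**: if `caseCDeadT … = true`, the pattern is duplicate-free and the mask of `T = −Q + Z°` has `|Q| + z` members, then for
every sequentially admissible choice `rs` of `c` translates from the cover `T`, the leaf holds at the resulting tiling.
[cite: CohnKleinbergSzegedyUmans2005, Def. 5.1] -/
theorem caseCLeafT_of_caseCDeadT {p c L z : ℕ} {Q P : List ℕ} {h₀ : ℕ} {tbl : List (List ℕ × List ℕ)}
    (h : caseCDeadT p c L z Q P h₀ tbl = true) (hpatt : (pattPQ p P Q).Nodup)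
    (hT : popc (List.range p)
      (Q.foldl (fun m q => m ||| rot p (maskOf ((List.range (z + 1)).filter fun t => !(Nat.beq t h₀))) (p - q)) 0) = Q.length + z)
    (rs : List (ℕ × ℕ)) (hsub : rs.Sublist (transMasks p (pattPQ p P Q))) (hlen : rs.length = c)
    (hadm : admissible (Q.foldl (fun m q => m ||| rot p (maskOf ((List.range (z + 1)).filter fun t => !(Nat.beq t h₀))) (p - q)) 0) rs = true) :
    caseCLeafT p L P ((List.range (z + 1)).filter fun t => !(Nat.beq t h₀)) tbl (rs.map Prod.fst)
      (rs.foldl (fun cv x => cv ||| x.2)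
        (Q.foldl (fun m q => m ||| rot p (maskOf ((List.range (z + 1)).filter fun t => !(Nat.beq t h₀))) (p - q)) 0)) = true := by
  unfold caseCDeadT at h
  simp only [hpatt, decide_true, Bool.not_true, Bool.false_or, hT, Nat.beq_refl] at h
  by_contra hleaf
  rw [Bool.not_eq_true] at hleaf
  have key := tilesAll_complete (caseCLeafT p L P ((List.range (z + 1)).filter fun t => !(Nat.beq t h₀)) tbl) _ rs [] _ hsub hadm
    (by simpa using hleaf)
  rw [hlen, h] at key
  exact Bool.noConfusion key

end Summit.MatrixMultiplication.OmegaCensus.CubeNB.S2
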